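import Mathlib
import Summits.Ventures.PercRepro2.PMK5Deg3Kernel
import Summits.Ventures.PercRepro2.PMK5Deg4Kernel
import Summits.Ventures.PercRepro2.PMK5Deg4Kernel5
import Summits.Ventures.PercRepro2.PMK5Deg4LitsOA1A2B4
import Summits.Ventures.PercRepro2.PMK5Deg4CertOA1A2BD0
import Summits.Ventures.PercRepro2.PMK5Deg4CertOA1A2BD1
import Summits.Ventures.PercRepro2.PMK5Deg4CertOA1A2BD2
import Summits.Ventures.PercRepro2.PMK5Deg4CertOA1A2BD3
import Summits.Ventures.PercRepro2.Deg4Conn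
import Summits.Ventures.PercRepro2.Deg4Typed

/-!
# THEOREM 29 ON THE QUADRUPLE `(0, 1, 2, 4)`: ROW 2′TRI AND (HCOV) ON `K₅ + {a₃o, a₃a₁, a₃a₂, a₃b}` FOR EVERY WEIGHT VECTOR
(blind cell PercRepro2, mine-2 g28; the degree-4 rung of Theorem 28 — `K₆` minus the edge `u a₃`)

The `1024` five-digit slice certificates `cert_oa1a2b` (`PMK5Deg4CertsOA1A2B01–36.lean`, assembled by first digit in
`PMK5Deg4CertOA1A2BD0–3.lean`) and the `608` certified literals `Five.litOK_oa1a2b` (`PMK5Deg4LitsOA1A2B0–4.lean`), read through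
the five-digit slice decomposition and the digit bridge by `Deg4Typed.HCov_deg4`.  Standard axioms only.
-/

namespace Summit.Ventures.PercRepro2

namespace Deg4

/-- **All `1024` slice certificates of the quadruple `(0, 1, 2, 4)`.** -/
theorem cert_oa1a2b : Five.Cert Five.Loa1a2b := by
  intro j₁ j₂ j₃ j₄ j₅
  fin_cases j₁
  · exact Five.cert_oa1a2b_0 j₂ j₃ j₄ j₅
  · exact Five.cert_oa1a2b_1 j₂ j₃ j₄ j₅
  · exact Five.cert_oa1a2b_2 j₂ j₃ j₄ j₅
  · exact Five.cert_oa1a2b_3 j₂ j₃ j₄ j₅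

variable {R : Type*} [Field R] [LinearOrder R] [IsStrictOrderedRing R]

/-- **Row 2′TRI on `K₅ + {a₃o, a₃a₁, a₃a₂, a₃b}`**: every weight-free typed count of `K₃` is nonnegative. -/
theorem typedBases_oa1a2b : CovForm.TypedBases (R := R) (ends14 0 1 2 4) 0 1 2 5 4 :=
  typedBases 0 1 2 4 Five.litOK_oa1a2b cert_oa1a2b

/-- **THEOREM 29 on the quadruple `(0, 1, 2, 4)`: (HCOV) on `K₅ + {a₃o, a₃a₁, a₃a₂, a₃b}` — `K₆` minus the edge `u a₃` — for every
weight vector** (missing edges at weight `0`). -/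
theorem HCov_deg4_oa1a2b (p : Fin 14 → R) (hp : IsProbVec p) : CovForm.HCov p (ends14 0 1 2 4) 0 1 2 5 4 :=
  HCov_deg4 0 1 2 4 Five.litOK_oa1a2b cert_oa1a2b p hp

end Deg4

end Summit.Ventures.PercRepro2
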